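import Literature.NumberTheory.Transcendental.EllipticPeriodLogSpanProofs
import HarnessLib

/-!
# Philippon's zero estimate on `M_κ` with at most one elliptic factor, CM allowed (named fact),
# and `ellipticPeriod_not_mem_logSpan` assembled from it

Topic: `Literature/NumberTheory/Transcendental`. Fact-decomposition record (librarian,
`fact-decompose`, 2026-08-16) for the named fact `ellipticPeriod_not_mem_logSpan`
(`EllipticPeriodLogSpan.lean`; Huber–Wüstholz 2022, Thm. 15.3 (1) for `M = [ℤʳ → 𝔾ₘʳ] × [0 → E]`:
a non-zero period of an elliptic curve over `ℚ̄`, complex multiplication allowed, is not a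
`ℚ̄`-linear combination of `1` and logarithms of algebraic numbers).

State of the printed proof in the tree (`EllipticPeriodLogSpanProofs.lean`, module docstring and
`ellipticPeriod_not_mem_logSpan_of_zeroEstimate_oneFactor`): the whole fact — every lattice with
algebraic invariants, CM or not — follows from Philippon's zero estimate (1986, Thm. 2.1) on the
group varieties `M_κ = 𝔾ₘ^β × P_κ` with AT MOST ONE elliptic factor; everything between that zero
estimate and the fact (Baker's method on `M_κ`, the Semistability Theorem at torsion points for one
lattice — `SemistabilityOneFactor.lean` —, the dévissage to the period-point analytic subgroup
theorem and the linear algebra of Steps 1–2) is PROVED there. The zero estimate was carried only as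
the hypothesis `hZ` ("not vendored as a named fact by this unit, D-0026"). The tree's named fact
`philippon1986_std` (`PhilipponZeroEstimateStd.lean`) is the same printed theorem for all `κ` but
with the binder `¬ L.HasCM`, which its obstruction list `GaGmE.Std.SubgroupDataC` needs as soon as
`|γ| ≥ 2`; for `|γ| ≤ 1` the list `0, 𝔾ₐ, E♮` (times the torus data) is complete with or without
complex multiplication, so Philippon's printed theorem applies verbatim to every lattice
(`EllipticPeriodLogSpanProofs`, "What is NOT here, and why (the CM case)").

This file NAMES that input as the fact `philippon1986_oneFactor` — the body of `philippon1986_std`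
without `¬ L.HasCM` and with `Fintype.card γ ≤ 1`, i.e. the hypothesis `hZ` of
`ellipticPeriod_not_mem_logSpan_of_zeroEstimate_oneFactor` verbatim — and records the assembly
`ellipticPeriod_not_mem_logSpan_holds_of` (one line). The non-CM lattices are also served by
`philippon1986_std` (`ellipticPeriod_not_mem_logSpan_of_philippon_of_zeroEstimate_hasCM`); the new
fact is what the CM case needs and suffices alone.

## References

* [Philippon1986] P. Philippon, Lemmes de zéros dans les groupes algébriques commutatifs, Bull.
  Soc. Math. France 114 (1986) 355–383: Thm 2.1 (§2, pp. 357–358).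
* [HuberWustholz2022] A. Huber, G. Wüstholz, Transcendence and Linear Relations of 1-Periods,
  Cambridge Tracts in Math. 227 (2022): Thm. 15.3 (1), Thm. 6.2.
* [BakerWustholz2007] A. Baker, G. Wüstholz, Logarithmic Forms and Diophantine Geometry (2007):
  Thm. 6.1, Thm. 6.14–6.15, §6.8.
-/

noncomputable section

open Complex

namespace Literature.NumberTheory.Transcendental

open GaGmE GaGmE.Std in
/-- NAMED FACT — **Philippon's zero estimate (1986, Théorème 2.1) on the group varieties
`M_κ = 𝔾ₘ^β × P_κ` with at most one elliptic factor, for every lattice with algebraic invariants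
(complex multiplication allowed).** Let `Λ = L.lattice` have algebraic invariants `g₂, g₃`,
`κ ∈ ℚ̄^{δ×γ}` with `|γ| ≤ 1`, `M_κ ⊂ ℙ^N` embedded by the theta functions of `PkappaTheta.lean`,
`n = dim M_κ = |β| + |γ| + |δ|`. There is `c > 0` such that: for a subspace `𝔟 ≠ 0` of
`Lie M_κ,ℂ`, a point `g = exp v`, a form `P` of degree `D ≥ 1` with `F_P = P(Θ) ≢ 0` and integers
`S ≥ 1`, `T ≥ 0`, if `F_P` vanishes to order `≥ nT + 1` along `𝔟` at `s·v` for all `0 ≤ s ≤ nS`,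
then some connected algebraic subgroup `G'` of `M_κ,ℂ` (`GaGmE.Std.SubgroupDataC` — a complete list
when `|γ| ≤ 1`, CM or not) is contained in a translate of the zero set of `P` and satisfies
`binom(T + e, e) · card((Σ + G')/G') · D^{dim G'} ≤ c · D^n`, `e = dim 𝔟 - dim(𝔟 ∩ Lie G')`.
This is the body of `philippon1986_std` without its binder `¬ L.HasCM` and restricted to
`Fintype.card γ ≤ 1` — the hypothesis `hZ` of `ellipticPeriod_not_mem_logSpan_of_zeroEstimate_oneFactor`
verbatim (dictionary with the printed statement: module docstring of `PhilipponZeroEstimateStd`).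
Users take `(h : philippon1986_oneFactor)`. [cite: Philippon1986, Thm 2.1] -/
def philippon1986_oneFactor : Prop :=
  ∀ (L : PeriodPair), IsAlgebraic ℚ L.g₂ → IsAlgebraic ℚ L.g₃ →
    ∀ (β γ δ : Type) [Fintype β] [Fintype γ] [Fintype δ] [DecidableEq γ]
    (κM : δ → γ → Kbar), Fintype.card γ ≤ 1 →
    ∃ c : ℝ, 0 < c ∧ ∀ (𝔟 : Submodule ℂ (β ⊕ (γ ⊕ δ) → ℂ)) (v : β ⊕ (γ ⊕ δ) → ℂ)
      (P : MvPolynomial (Option β × ThetaIdx γ δ) ℂ) (D S T : ℕ),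
      0 < Module.finrank ℂ 𝔟 → 1 ≤ D → 1 ≤ S → P.IsHomogeneous D →
      (∃ w, thetaEval L κM P w ≠ 0) →
      (∀ s : ℕ, s ≤ Fintype.card (β ⊕ (γ ⊕ δ)) * S →
        VanishesAlong 𝔟 (thetaEval L κM P) ((s : ℂ) • v) (Fintype.card (β ⊕ (γ ⊕ δ)) * T + 1)) →
      ∃ K : SubgroupDataC β γ δ κM,
        (∃ w₀, ∀ w ∈ K.tangent, thetaEval L κM P (w₀ + w) = 0) ∧
        (Nat.choose (T + (Module.finrank ℂ 𝔟 - Module.finrank ℂ ↥(𝔟 ⊓ K.tangent)))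
            (Module.finrank ℂ 𝔟 - Module.finrank ℂ ↥(𝔟 ⊓ K.tangent)) : ℝ) *
          (orbitCard L κM K v S : ℝ) * (D : ℝ) ^ Module.finrank ℂ K.tangent ≤
          c * (D : ℝ) ^ Fintype.card (β ⊕ (γ ⊕ δ))

/-- **Assembly (fact-decompose): `ellipticPeriod_not_mem_logSpan` from Philippon's one-factor zero
estimate** — by `ellipticPeriod_not_mem_logSpan_of_zeroEstimate_oneFactor` (Baker's method on `M_κ`,
the Semistability Theorem for one lattice, the dévissage and Steps 1–2, all proved in the tree).
[cite: HuberWustholz2022, Thm. 15.3 (1) with Thm. 6.2] [cite: Philippon1986, Thm 2.1] -/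
theorem ellipticPeriod_not_mem_logSpan_holds_of (h : philippon1986_oneFactor) :
    ellipticPeriod_not_mem_logSpan :=
  ellipticPeriod_not_mem_logSpan_of_zeroEstimate_oneFactor h

/-- The non-CM part of the new fact is already covered by `philippon1986_std` (same body, all `κ`,
binder `¬ L.HasCM`): for lattices without complex multiplication the one-factor zero estimate is an
instance of it. [cite: Philippon1986, Thm 2.1] -/
theorem philippon1986_oneFactor_of_std_of_not_hasCM (h : philippon1986_std) (L : PeriodPair)
    (h₂ : IsAlgebraic ℚ L.g₂) (h₃ : IsAlgebraic ℚ L.g₃) (hCM : ¬ L.HasCM)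
    (β γ δ : Type) [Fintype β] [Fintype γ] [Fintype δ] [DecidableEq γ]
    (κM : δ → γ → GaGmE.Kbar) :
    ∃ c : ℝ, 0 < c ∧ ∀ (𝔟 : Submodule ℂ (β ⊕ (γ ⊕ δ) → ℂ)) (v : β ⊕ (γ ⊕ δ) → ℂ)
      (P : MvPolynomial (Option β × GaGmE.Std.ThetaIdx γ δ) ℂ) (D S T : ℕ),
      0 < Module.finrank ℂ 𝔟 → 1 ≤ D → 1 ≤ S → P.IsHomogeneous D →
      (∃ w, GaGmE.Std.thetaEval L κM P w ≠ 0) →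
      (∀ s : ℕ, s ≤ Fintype.card (β ⊕ (γ ⊕ δ)) * S →
        GaGmE.Std.VanishesAlong 𝔟 (GaGmE.Std.thetaEval L κM P) ((s : ℂ) • v)
          (Fintype.card (β ⊕ (γ ⊕ δ)) * T + 1)) →
      ∃ K : GaGmE.Std.SubgroupDataC β γ δ κM,
        (∃ w₀, ∀ w ∈ K.tangent, GaGmE.Std.thetaEval L κM P (w₀ + w) = 0) ∧
        (Nat.choose (T + (Module.finrank ℂ 𝔟 - Module.finrank ℂ ↥(𝔟 ⊓ K.tangent)))
            (Module.finrank ℂ 𝔟 - Module.finrank ℂ ↥(𝔟 ⊓ K.tangent)) : ℝ) *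
          (GaGmE.Std.orbitCard L κM K v S : ℝ) * (D : ℝ) ^ Module.finrank ℂ K.tangent ≤
          c * (D : ℝ) ^ Fintype.card (β ⊕ (γ ⊕ δ)) :=
  h L h₂ h₃ hCM β γ δ κM

end Literature.NumberTheory.Transcendental

end
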